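import Summits.ABC.IUTFork.Repair.RHHullCellSliceLicence
import HarnessLib

/-!
# D-0121 Q1 (T-OPTIMALITY), R33(4) — «THE CREDIT IS CONDUCTOR-TYPE»: at the diagonal packet of one local field the cell slack
# (= the netting credit of LP-2b) is at most `(|I|·(D + R_in − R_out)/e)·log p` — different + log-shell, HEIGHT-FREE

PROOF-ONLY file (0 definitions, 0 `Prop` facts, no instance, no notation) of the abc-iut cell, rung LADDER-ABC:A2.RESCUE.H, seat
abc-iut-rh2-T-1 (gen 3), answering rh-lead g3's ASK R33(a) (HOME/STATUS 2026-08-27T03:03:18Z «type `credit_le_shellBudget` … or the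
sharpest kernel form from p481438 + the GShell lemma»). SEQUEL, by name, of abc-iut-rh-typ-4's `Repair/RHCellSlackExactOrders.lean` (imported through `Repair/RHHullCellSliceLicence.lean`, whose `outerRadius_le_innerRadius` is reused)
(`cellSlack_diag_orders`: at the DIAGONAL packet of one field `K` — `|I|` slots, Θ-slot scalars of norm `‖ϖ‖^M`, `‖t_q‖ = ‖ϖ‖^{m_q}`,
different exponent `D`, inner radius `‖c_in‖ = ‖ϖ‖^{R_in}`, outer radius `‖c_out‖ = ‖ϖ‖^{R_out}` = the largest norm on `log_p(𝒪_K^×)` —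
the cell slack `log μ̄(hull) − log μ̄(q-box)` IS `((m_q − e·m⋆ − |I|·R_out)/e)·log p`, `m⋆ = ⌊(M − (|I|−1)·D − |I|·R_in)/e⌋`, i.e.
`(log p/e)·marg` with the R-W / R-H tables' integer margin).

WHAT IS TYPED (namespace `Summit.ABC.IUTFork.Repair.RHCreditShellBudget`):
* §1 INTEGER BOOKKEEPING (the «GShell» shape of abc-iut-rh3-ref-1, `price_j ≤ (j+1)(δ + G)`, here for the exact margin):
  `margin_le_sharp` — `marg ≤ −(M − m_q) + (|I|−1)·D + |I|·(R_in − R_out) + (e − 1)` for ALL integers (floor bookkeeping only);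
  `margin_le_shellBudget` — if `m_q ≤ M` (the Θ-slots are at least as deep as the q-slot: at label `j`, `M = j²·m_q ≥ m_q`) and
  `e − 1 ≤ D` (the different exponent of a ramified field; `D ≥ e − 1` always, [Serre, Corps locaux III §6 Prop. 13]) then
  **`marg ≤ |I|·(D + (R_in − R_out))`** — NO `m_q`, NO `M`: the demand `(j²−1)·m_q` (the HEIGHT-type term) has been discarded with the
  right sign, what is left is the different `D` and the log-shell span `G := R_in − R_out` (CONDUCTOR-type, per slot).
* §2 REAL FORM AT THE PACKET: `cellSlack_diag_le_sharp`, **`cellSlack_diag_le_shellBudget`** — under the hypotheses of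
  `cellSlack_diag_orders` plus `m_q ≤ M`, `e − 1 ≤ D`: `log μ̄(hull(Ind2·⋃_a ι_a(x_a)·(R_I)^∼)) − log μ̄(ι_{b'}(t_q)·(R_I)^∼) ≤ (|I|·(D + R_in − R_out)/e)·log p`;
  and — the inner ball lies in the shell, `R_out ≤ R_in` (`RH.HullCellSliceLicence.outerRadius_le_innerRadius`), so the budget is `≥ 0` — the
  CREDIT form **`cellCredit_diag_le_shellBudget`**: `max (slack) 0 ≤ (|I|·(D + R_in − R_out)/e)·log p`.
READING (D-0121 R33(4) scaling sentence, kernel side): per cell `(j, w)` the netting credit `(−cellDeficit)⁺` of the sharp setting — whose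
packet value is this slack by abc-iut-rh-typ-4's p481438 `cellSlack_settingPrVolSharp_eq` (Pr-weighted over tuples; diagonal = one-type
fibre) — is at most `(j+1)·(D_w + G_w)·(log p_w)/e_w`: l enters only through `j + 1 ≤ l⋆ + 1`, the HEIGHT (`m_q`, `M = j²m_q`) not at all;
summed with the procession normalisation `PN` (weight `1/l⋆`) over labels this is `≤ ((l⋆+3)/2)·(D_w + G_w)·(log p_w)/e_w` per place — a
log-different + log-shell budget of the kind [IUTchIV] Thm. 1.10's `B_III(P,l)` / `Tol(P,l)` carry — against the identification DEBT
`(j²−1)·m_q·(log p_w)/(e_w·l⋆)` per unlicensed cell, which grows with the local height. The GLOBAL sum `credit ≤ PN Σ …` over the genuine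
setting's cells needs the packet → place bookkeeping of mixed fibres (p481438 HONEST SCOPE) and is NOT typed here; this file is the per-packet
kernel input of that sentence. HONEST FRAMING: classical lattice arithmetic over the cell's REAL definitions at ONE diagonal packet with
prescribed integer data; nothing here decides any cell at genuine data, asserts or denies [IUTchIII] Cor. 3.12, or bears on abc; no side
taken on any author (Mochizuki / Scholze–Stix / Joshi / Dupuy–Hilado); typed ≠ proved for anything not named as a theorem; instantiated ≠
endorsed. [claim: Mochizuki2012, status: disputed] for every quoted construction. [cite: DupuyHilado2025, §3.7, §4.9, §4.12]
[cite: Mochizuki2012, IUTchIV Prop. 1.2 (i)(ii) p. 10, Prop. 1.4 (iii) p. 13–14, Thm. 1.10 Step (v) p. 27–28] [cite: NeukirchANT1999, Ch. II (5.5)]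
-/

noncomputable section

open Set Function
open scoped Pointwise

namespace Summit.ABC.IUTFork.Repair.RHCreditShellBudget

open Literature.IUT.LogVolume Literature.NumberTheory.GaloisRepresentations.Ultrametric Summit.ABC.IUTFork.Cor312Vol
  Summit.ABC.IUTFork.Repair.RHCellSlackExactOrders

/-! ## §1. Integer bookkeeping: the margin against the shell budget -/

/-- **Floor bookkeeping, no hypotheses on the data**: with `m⋆ := ⌊X/e⌋`, `X := M − (n−1)·D − n·R_in`, one has `e·m⋆ ≥ X − (e−1)`, hence
`marg := m_q − e·m⋆ − n·R_out ≤ −(M − m_q) + (n−1)·D + n·(R_in − R_out) + (e − 1)`. [folklore] -/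
theorem margin_le_sharp {e : ℤ} (he : 0 < e) (n D : ℕ) (Rin Rout M mq : ℤ) :
    mq - e * ((M - (n - 1 : ℕ) * (D : ℤ) - n * Rin) / e) - n * Rout ≤
      -(M - mq) + (n - 1 : ℕ) * (D : ℤ) + n * (Rin - Rout) + (e - 1) := by
  set X : ℤ := M - (n - 1 : ℕ) * (D : ℤ) - n * Rin with hX
  have h1 : e * (X / e) + X % e = X := Int.mul_ediv_add_emod X e
  have h2 : X % e < e := Int.emod_lt_of_pos X he
  have h3 : mq - e * (X / e) - n * Rout = mq - X + X % e - n * Rout := by linarith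
  rw [h3, hX]
  linarith

/-- **THE MARGIN AGAINST THE SHELL BUDGET**: if the Θ-slots are at least as deep as the q-slot (`m_q ≤ M`; at a label `j`, `M = j²·m_q`)
and `e − 1 ≤ D` (different exponent of the field), then `marg ≤ n·(D + (R_in − R_out))` — different + log-shell span per slot, NO height
term. (abc-iut-rh3-ref-1's «GShell» `price_j ≤ (j+1)(δ + G)` for the exact margin.) [folklore] -/
theorem margin_le_shellBudget {e : ℤ} (he : 0 < e) {n : ℕ} (hn : 1 ≤ n) {D : ℕ} (hD : e - 1 ≤ (D : ℤ)) {Rin Rout M mq : ℤ}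
    (hM : mq ≤ M) :
    mq - e * ((M - (n - 1 : ℕ) * (D : ℤ) - n * Rin) / e) - n * Rout ≤ n * ((D : ℤ) + (Rin - Rout)) := by
  have h := margin_le_sharp he n D Rin Rout M mq
  have hcast : ((n - 1 : ℕ) : ℤ) = (n : ℤ) - 1 := by
    rw [Nat.cast_sub hn, Nat.cast_one]
  rw [hcast] at h ⊢
  have hring : ((n : ℤ) - 1) * (D : ℤ) = n * (D : ℤ) - D := by ring
  rw [hring] at h ⊢
  have hring2 : (n : ℤ) * ((D : ℤ) + (Rin - Rout)) = n * (D : ℤ) + n * (Rin - Rout) := by ring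
  rw [hring2]
  have hD0 : (0 : ℤ) ≤ D := Nat.cast_nonneg D
  linarith

/-! ## §2. At the diagonal packet of one field: the slack against the shell budget -/

variable (p : ℕ) [Fact p.Prime] {I : Type} [Fintype I] [DecidableEq I] [Nonempty I]
  {K : Type} [NontriviallyNormedField K] [NormedAlgebra ℚ_[p] K] [IsUltrametricDist K] [ProperSpace K]

omit [DecidableEq I] [Nonempty I] in
/-- Casting an integer inequality into the packet's real currency: `z ≤ w ⟹ (z/e)·log p ≤ (w/e)·log p`. [folklore] -/
theorem div_mul_log_le_of_le {z w : ℤ} (h : z ≤ w) :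
    ((z : ℤ) : ℝ) / (absRamificationIdx p K : ℝ) * Real.log p ≤ ((w : ℤ) : ℝ) / (absRamificationIdx p K : ℝ) * Real.log p := by
  have hp1 : (1 : ℝ) < p := by exact_mod_cast (Fact.out : p.Prime).one_lt
  have hlog : 0 < Real.log p := Real.log_pos hp1
  have he : (0 : ℝ) < absRamificationIdx p K := by exact_mod_cast absRamificationIdx_pos p K
  have hzw : ((z : ℤ) : ℝ) ≤ ((w : ℤ) : ℝ) := by exact_mod_cast h
  exact mul_le_mul_of_nonneg_right (div_le_div_of_nonneg_right hzw he.le) hlog.le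

/-- **The slack at the diagonal packet, SHARP integer bound**: `slack ≤ ((−(M − m_q) + (|I|−1)·D + |I|·(R_in − R_out) + (e−1))/e)·log p`
(`cellSlack_diag_orders` + `margin_le_sharp`; no hypothesis on the depths). [cite: DupuyHilado2025, §4.12] [claim: Mochizuki2012, status: disputed] -/
theorem cellSlack_diag_le_sharp {ϖ : Kˣ} (hϖ : IsUniformizer ϖ) {D : ℕ}
    (hD : differentOrd p K = (D : ℝ) / absRamificationIdx p K) {cin cout : K}
    (hin : ∀ o : K, ‖o‖ ≤ 1 → cin * o ∈ logUnits K)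
    (hmax : ∃ (ϖ' : Kˣ) (w : K), IsUniformizer ϖ' ∧ w ∉ logUnits K ∧ ‖w‖ * ‖(ϖ' : K)‖ ≤ ‖cin‖)
    (houtΛ : cout ∈ logUnits K) (hdom : ∀ z ∈ logUnits K, ‖z‖ ≤ ‖cout‖)
    {Rin Rout : ℤ} (hRin : ‖cin‖ = ‖(ϖ : K)‖ ^ Rin) (hRout : ‖cout‖ = ‖(ϖ : K)‖ ^ Rout)
    {x : I → K} {M : ℤ} (hx : ∀ a, ‖x a‖ = ‖(ϖ : K)‖ ^ M) (b' : I) {tq : K} {mq : ℤ} (hq : ‖tq‖ = ‖(ϖ : K)‖ ^ mq) :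
    packetLogμ p (fun _ : I => K) (packetHull p (fun _ : I => K) (⋃ g : indTwo p (fun _ : I => K),
          g • ⋃ a, iota p (fun _ : I => K) a (x a) • (normalizedPacket p (fun _ : I => K) : Set (PacketAlgebra p (fun _ : I => K))))) -
        packetLogμ p (fun _ : I => K)
          (iota p (fun _ : I => K) b' tq • (normalizedPacket p (fun _ : I => K) : Set (PacketAlgebra p (fun _ : I => K)))) ≤
      ((-(M - mq) + (Fintype.card I - 1 : ℕ) * (D : ℤ) + Fintype.card I * (Rin - Rout) + ((absRamificationIdx p K : ℤ) - 1) : ℤ) : ℝ) /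
          absRamificationIdx p K * Real.log p := by
  rw [cellSlack_diag_orders p hϖ hD hin hmax houtΛ hdom hRin hRout hx b' hq]
  have he0 : (0 : ℤ) < absRamificationIdx p K := by exact_mod_cast absRamificationIdx_pos p K
  exact div_mul_log_le_of_le p (margin_le_sharp he0 (Fintype.card I) D Rin Rout M mq)

/-- **`credit ≤ shell budget` AT THE DIAGONAL PACKET**: if the Θ-slot scalars are at least as deep as the q-slot (`m_q ≤ M`; at the
label `j` of the sharp setting `M = j²·m_q`) and `e − 1 ≤ D`, then the cell slack — the netting credit when `≥ 0` — satisfies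
`slack ≤ (|I|·(D + R_in − R_out)/e)·log p`: the different plus the log-shell span, once per slot, HEIGHT-FREE (no `m_q`, no `M`).
D-0121 R33(4): «the across-places credit is conductor-type». [cite: DupuyHilado2025, §4.12] [cite: Mochizuki2012, IUTchIV Prop. 1.2 (i)(ii) p. 10]
[claim: Mochizuki2012, status: disputed] -/
theorem cellSlack_diag_le_shellBudget {ϖ : Kˣ} (hϖ : IsUniformizer ϖ) {D : ℕ}
    (hD : differentOrd p K = (D : ℝ) / absRamificationIdx p K) (hDe : (absRamificationIdx p K : ℤ) - 1 ≤ (D : ℤ)) {cin cout : K}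
    (hin : ∀ o : K, ‖o‖ ≤ 1 → cin * o ∈ logUnits K)
    (hmax : ∃ (ϖ' : Kˣ) (w : K), IsUniformizer ϖ' ∧ w ∉ logUnits K ∧ ‖w‖ * ‖(ϖ' : K)‖ ≤ ‖cin‖)
    (houtΛ : cout ∈ logUnits K) (hdom : ∀ z ∈ logUnits K, ‖z‖ ≤ ‖cout‖)
    {Rin Rout : ℤ} (hRin : ‖cin‖ = ‖(ϖ : K)‖ ^ Rin) (hRout : ‖cout‖ = ‖(ϖ : K)‖ ^ Rout)
    {x : I → K} {M : ℤ} (hx : ∀ a, ‖x a‖ = ‖(ϖ : K)‖ ^ M) (b' : I) {tq : K} {mq : ℤ} (hq : ‖tq‖ = ‖(ϖ : K)‖ ^ mq) (hMq : mq ≤ M) :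
    packetLogμ p (fun _ : I => K) (packetHull p (fun _ : I => K) (⋃ g : indTwo p (fun _ : I => K),
          g • ⋃ a, iota p (fun _ : I => K) a (x a) • (normalizedPacket p (fun _ : I => K) : Set (PacketAlgebra p (fun _ : I => K))))) -
        packetLogμ p (fun _ : I => K)
          (iota p (fun _ : I => K) b' tq • (normalizedPacket p (fun _ : I => K) : Set (PacketAlgebra p (fun _ : I => K)))) ≤
      ((Fintype.card I * ((D : ℤ) + (Rin - Rout)) : ℤ) : ℝ) / absRamificationIdx p K * Real.log p := by
  rw [cellSlack_diag_orders p hϖ hD hin hmax houtΛ hdom hRin hRout hx b' hq]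
  have he0 : (0 : ℤ) < absRamificationIdx p K := by exact_mod_cast absRamificationIdx_pos p K
  exact div_mul_log_le_of_le p (margin_le_shellBudget he0 Fintype.card_pos hDe hMq)

/-- **THE CREDIT FORM**: under the same hypotheses the netting credit of the packet, `max (slack) 0`, is at most the shell budget
`(|I|·(D + R_in − R_out)/e)·log p` (which is `≥ 0`: `R_out ≤ R_in`, abc-iut-rh2-w-2's `RH.HullCellSliceLicence.outerRadius_le_innerRadius`). [cite: DupuyHilado2025, §4.12] [claim: Mochizuki2012, status: disputed] -/
theorem cellCredit_diag_le_shellBudget {ϖ : Kˣ} (hϖ : IsUniformizer ϖ) {D : ℕ}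
    (hD : differentOrd p K = (D : ℝ) / absRamificationIdx p K) (hDe : (absRamificationIdx p K : ℤ) - 1 ≤ (D : ℤ)) {cin cout : K}
    (hin : ∀ o : K, ‖o‖ ≤ 1 → cin * o ∈ logUnits K)
    (hmax : ∃ (ϖ' : Kˣ) (w : K), IsUniformizer ϖ' ∧ w ∉ logUnits K ∧ ‖w‖ * ‖(ϖ' : K)‖ ≤ ‖cin‖)
    (houtΛ : cout ∈ logUnits K) (hdom : ∀ z ∈ logUnits K, ‖z‖ ≤ ‖cout‖)
    {Rin Rout : ℤ} (hRin : ‖cin‖ = ‖(ϖ : K)‖ ^ Rin) (hRout : ‖cout‖ = ‖(ϖ : K)‖ ^ Rout)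
    {x : I → K} {M : ℤ} (hx : ∀ a, ‖x a‖ = ‖(ϖ : K)‖ ^ M) (b' : I) {tq : K} {mq : ℤ} (hq : ‖tq‖ = ‖(ϖ : K)‖ ^ mq) (hMq : mq ≤ M) :
    max (packetLogμ p (fun _ : I => K) (packetHull p (fun _ : I => K) (⋃ g : indTwo p (fun _ : I => K),
          g • ⋃ a, iota p (fun _ : I => K) a (x a) • (normalizedPacket p (fun _ : I => K) : Set (PacketAlgebra p (fun _ : I => K))))) -
        packetLogμ p (fun _ : I => K)
          (iota p (fun _ : I => K) b' tq • (normalizedPacket p (fun _ : I => K) : Set (PacketAlgebra p (fun _ : I => K))))) 0 ≤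
      ((Fintype.card I * ((D : ℤ) + (Rin - Rout)) : ℤ) : ℝ) / absRamificationIdx p K * Real.log p := by
  refine max_le (cellSlack_diag_le_shellBudget p hϖ hD hDe hin hmax houtΛ hdom hRin hRout hx b' hq hMq) ?_
  have hp1 : (1 : ℝ) < p := by exact_mod_cast (Fact.out : p.Prime).one_lt
  have hlog : 0 < Real.log p := Real.log_pos hp1
  have he : (0 : ℝ) < absRamificationIdx p K := by exact_mod_cast absRamificationIdx_pos p K
  have hG : Rout ≤ Rin := RH.HullCellSliceLicence.outerRadius_le_innerRadius hϖ hin hdom hRin hRout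
  have hnn : (0 : ℤ) ≤ Fintype.card I * ((D : ℤ) + (Rin - Rout)) :=
    mul_nonneg (by exact_mod_cast (Nat.zero_le _)) (by have := (Nat.cast_nonneg D : (0:ℤ) ≤ D); linarith)
  have hnn' : (0 : ℝ) ≤ ((Fintype.card I * ((D : ℤ) + (Rin - Rout)) : ℤ) : ℝ) := by exact_mod_cast hnn
  exact mul_nonneg (div_nonneg hnn' he.le) hlog.le

end Summit.ABC.IUTFork.Repair.RHCreditShellBudget

end
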